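import Literature.Probability.Percolation.SiteInterfaceStructure
import Literature.Probability.Percolation.SiteInterfaceWinding
import Literature.Probability.Percolation.OneArmLSW
import Literature.Probability.Percolation.TriAnnulusArms
import Literature.Probability.Percolation.TriBoxCrossingLowerBound
import HarnessLib

/-!
# An open circuit inside two closed circuits forces a macroscopic cluster interface

Topic: Probability / Percolation. The deterministic core of the non-triviality of the scaling
limits of the critical site-percolation loop ensemble (F. Camia, C. M. Newman, Comm. Math. Phys.
268 (2006), Thm 2 (ii) and its proof: RSW circuits of alternating colours in concentric annuli
force large cluster boundaries between them). For a configuration `ω` with finitely many open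
sites (such as the restricted configurations `ω ∩ triMeshVertices D δ` of `CLE6.lean`) and a
lattice centre `c`, suppose that

* an **open** circuit `O` of `𝕋` lies in the annulus `4R < ‖· - c‖ < 8R` and meets every walk of
  `𝕋` from `‖x - c‖ ≤ 4R` to `‖y - c‖ ≥ 8R`,
* a **closed** circuit `C` lies in `16R < ‖· - c‖ < 32R` and blocks `(16R, 32R)` likewise,
* a **closed** circuit `C'` lies in `64R < ‖· - c‖ < 128R` and blocks `(64R, 128R)`,

with `R ≥ 1` (lattice units). Then (`exists_macroscopic_isSiteInterfaceLoop`) some interface loop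
`w` of `ω` has, at every mesh `δ > 0`, its trace inside the disc `B(δc, δ(128R + 2))` and two
points of its trace at distance `≥ δ(R - 1)`.

Proof. Follow the lattice ray from a site `p₀` of `O` in the direction `e₀`; it meets `C`
(blocking), so it enters the closed cluster `K'` of `C`; let `b` be its first site in `K'` and
`a` the site before: `a` is open (a closed `a` would be in `K'`) and `a ∼ b`, so an interface loop
`w` of `ω` crosses the dart `a → b` as its first step (`exists_isSiteInterfaceLoop_of_adj`,
`SiteInterfaceStructure.lean`). Its right (closed) sites stay in `K'`, which contains sites of
`C` far from `a`; its left site `a` is joined, through ray sites not in `K'` and then through `O`,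
to sites of `O` far from `a`; no edge of either chain is crossed by `w`. By the macroscopic-loop
lemma of `SiteInterfaceWinding.lean` (`not_polyTrace_subset_closedBall`: winding-number jump
across the crossed edge, transport along the chains, vanishing far away) the trace of `w` leaves
the disc `B̄(δa, δR)`. Finally every left (open) site of `w` lies in the open cluster of `a`,
which cannot cross the closed circuit `C'` (`‖a - c‖ ≤ 48R + 1 ≤ 64R`), so the trace stays in
`‖· - δc‖ < δ(128R + 2)`.

Everything is proved; no named facts are introduced.

## References

* F. Camia, C. M. Newman, Comm. Math. Phys. 268 (2006), Thm 2 (ii) [CamiaNewman2006].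
* B. Bollobás, O. Riordan, *Percolation* (2006), Ch. 7, Lemma 4 (RSW circuits) [BollobasRiordan2006].
-/

noncomputable section

open Set Metric

namespace Literature.Probability.Percolation

open LatticeModels

/-! ### Lattice rays in the directions `± e₀` -/

/-- The `k`-th site of the lattice ray from `p` in the direction `e₀`: `p + k e₀`. [folklore] -/
def raySite (p : Site 2) (k : ℕ) : Site 2 := p + Pi.single 0 (k : ℤ)

/-- The `k`-th site of the lattice ray from `p` in the direction `-e₀`: `p - k e₀`. [folklore] -/
def raySiteNeg (p : Site 2) (k : ℕ) : Site 2 := p - Pi.single 0 (k : ℤ)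

/-- The ray starts at `p`. [folklore] -/
@[simp] theorem raySite_zero (p : Site 2) : raySite p 0 = p := by simp [raySite]

/-- The negative ray starts at `p`. [folklore] -/
@[simp] theorem raySiteNeg_zero (p : Site 2) : raySiteNeg p 0 = p := by simp [raySiteNeg]

/-- One step along the ray is the unit vector `e₀ = triDir 0`. [folklore] -/
theorem raySite_succ (p : Site 2) (k : ℕ) : raySite p (k + 1) = raySite p k + triDir 0 := by
  simp only [raySite, triDir, Matrix.cons_val_zero, Nat.cast_succ, add_assoc, ← Pi.single_add]

/-- One step back along the negative ray is the unit vector `e₀`. [folklore] -/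
theorem raySiteNeg_succ_add (p : Site 2) (k : ℕ) : raySiteNeg p (k + 1) + triDir 0 = raySiteNeg p k := by
  simp only [raySiteNeg, triDir, Matrix.cons_val_zero, Nat.cast_succ, Pi.single_add]
  abel

/-- Consecutive ray sites are adjacent. [folklore] -/
theorem adj_raySite_succ (p : Site 2) (k : ℕ) : triGraph.Adj (raySite p k) (raySite p (k + 1)) := by
  rw [raySite_succ]; exact triGraph_adj_add_triDir _ 0

/-- Consecutive sites of the negative ray are adjacent. [folklore] -/
theorem adj_raySiteNeg_succ (p : Site 2) (k : ℕ) : triGraph.Adj (raySiteNeg p k) (raySiteNeg p (k + 1)) := by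
  have := triGraph_adj_add_triDir (raySiteNeg p (k + 1)) 0
  rw [raySiteNeg_succ_add] at this
  exact this.symm

/-- The embedded unit vector `k e₀` is the real number `k`. [folklore] -/
theorem triEmbed_single_zero_natCast (k : ℕ) : triEmbed (Pi.single 0 (k : ℤ) : Site 2) = k := by
  simp [triEmbed]

/-- Embedding of the ray relative to a centre: `p + k e₀ - c ↦ (p - c) + k`. [folklore] -/
theorem triEmbed_raySite_sub (p c : Site 2) (k : ℕ) :
    triEmbed (raySite p k - c) = triEmbed (p - c) + k := by
  rw [raySite, add_sub_right_comm, triEmbed_add, triEmbed_single_zero_natCast]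

/-- Embedding of the negative ray relative to a centre: `p - k e₀ - c ↦ (p - c) - k`. [folklore] -/
theorem triEmbed_raySiteNeg_sub (p c : Site 2) (k : ℕ) :
    triEmbed (raySiteNeg p k - c) = triEmbed (p - c) - k := by
  rw [raySiteNeg, sub_right_comm, triEmbed_sub, triEmbed_single_zero_natCast]

/-- Along the ray the distance to the centre grows at least linearly. [folklore] -/
theorem sub_le_norm_triEmbed_raySite_sub (p c : Site 2) (k : ℕ) :
    (k : ℝ) - ‖triEmbed (p - c)‖ ≤ ‖triEmbed (raySite p k - c)‖ := by
  rw [triEmbed_raySite_sub]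
  have h := norm_sub_norm_le ((k : ℂ)) (-(triEmbed (p - c)))
  rw [norm_neg, sub_neg_eq_add, add_comm] at h
  simpa using h

/-- Along the ray the distance to the centre grows at most linearly. [folklore] -/
theorem norm_triEmbed_raySite_sub_le (p c : Site 2) (k : ℕ) :
    ‖triEmbed (raySite p k - c)‖ ≤ ‖triEmbed (p - c)‖ + k := by
  rw [triEmbed_raySite_sub]
  exact (norm_add_le _ _).trans (by simp)

/-- The ray from the centre: distance exactly `k`. [folklore] -/
theorem norm_triEmbed_raySite_self_sub (c : Site 2) (k : ℕ) : ‖triEmbed (raySite c k - c)‖ = k := by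
  rw [triEmbed_raySite_sub, sub_self, triEmbed_zero, zero_add]; simp

/-- The negative ray from the centre: distance exactly `k`. [folklore] -/
theorem norm_triEmbed_raySiteNeg_self_sub (c : Site 2) (k : ℕ) : ‖triEmbed (raySiteNeg c k - c)‖ = k := by
  rw [triEmbed_raySiteNeg_sub, sub_self, triEmbed_zero, zero_sub, norm_neg]; simp

/-- **The walk along a stretch of the ray** `p + i e₀, …, p + j e₀`. [folklore] -/
theorem exists_walk_raySite (p : Site 2) (j : ℕ) :
    ∃ q : triGraph.Walk (raySite p 0) (raySite p j), ∀ z ∈ q.support, ∃ k ≤ j, z = raySite p k := by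
  obtain ⟨q, hq⟩ := exists_triWalk_of_chain (raySite p) j fun i _ ↦ Or.inr (adj_raySite_succ p i)
  exact ⟨q, hq⟩

/-- The walk along a stretch of the negative ray. [folklore] -/
theorem exists_walk_raySiteNeg (p : Site 2) (j : ℕ) :
    ∃ q : triGraph.Walk (raySiteNeg p 0) (raySiteNeg p j), ∀ z ∈ q.support, ∃ k ≤ j, z = raySiteNeg p k := by
  obtain ⟨q, hq⟩ := exists_triWalk_of_chain (raySiteNeg p) j fun i _ ↦ Or.inr (adj_raySiteNeg_succ p i)
  exact ⟨q, hq⟩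

/-! ### Far points of a blocking circuit -/

/-- **A blocking circuit has a site far from any given point.** If the closed walk `O` meets
every walk of `𝕋` from `‖x - c‖ ≤ r₁` to `‖y - c‖ ≥ r₂` (`0 ≤ r₁ ≤ r₂`) and its sites are at
distance `> r₁` from `c`, then for every site `a` some site of `O` is at (embedded) distance
`> r₁` from `a`: `O` meets the two rays from `c` in the directions `± e₀` at sites `c + i e₀`,
`c - i' e₀` with `i, i' > r₁`, which are `> 2 r₁` apart. [folklore] -/
theorem exists_mem_support_lt_norm_of_blocking {c : Site 2} {r₁ r₂ : ℝ} (hr₁ : 0 ≤ r₁) {v : Site 2}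
    {O : triGraph.Walk v v} (hann : ∀ x ∈ O.support, r₁ < ‖triEmbed (x - c)‖)
    (hblock : ∀ (x y : Site 2) (q : triGraph.Walk x y), ‖triEmbed (x - c)‖ ≤ r₁ →
      r₂ ≤ ‖triEmbed (y - c)‖ → ∃ z ∈ q.support, z ∈ O.support)
    (a : Site 2) : ∃ z ∈ O.support, r₁ < ‖triEmbed (z - a)‖ := by
  set N : ℕ := ⌈r₂⌉₊ with hN
  -- the positive ray
  obtain ⟨qp, hqp⟩ := exists_walk_raySite c N
  obtain ⟨zp, hzpq, hzpO⟩ := hblock _ _ qp (by rw [raySite_zero, sub_self, triEmbed_zero, norm_zero]; exact hr₁)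
    (by rw [norm_triEmbed_raySite_self_sub]; exact Nat.le_ceil _)
  obtain ⟨i, -, rfl⟩ := hqp zp hzpq
  -- the negative ray
  obtain ⟨qn, hqn⟩ := exists_walk_raySiteNeg c N
  obtain ⟨zn, hznq, hznO⟩ := hblock _ _ qn (by rw [raySiteNeg_zero, sub_self, triEmbed_zero, norm_zero]; exact hr₁)
    (by rw [norm_triEmbed_raySiteNeg_self_sub]; exact Nat.le_ceil _)
  obtain ⟨i', -, rfl⟩ := hqn zn hznq
  have hi : r₁ < i := by have := hann _ hzpO; rwa [norm_triEmbed_raySite_self_sub] at this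
  have hi' : r₁ < i' := by have := hann _ hznO; rwa [norm_triEmbed_raySiteNeg_self_sub] at this
  -- the two hits are `i + i'` apart
  have hdiff : triEmbed (raySite c i - a) - triEmbed (raySiteNeg c i' - a) = (i : ℂ) + i' := by
    rw [triEmbed_raySite_sub, triEmbed_raySiteNeg_sub]
    ring
  by_contra hno
  push Not at hno
  have h1 := hno _ hzpO
  have h2 := hno _ hznO
  have h3 : ‖(i : ℂ) + i'‖ ≤ ‖triEmbed (raySite c i - a)‖ + ‖triEmbed (raySiteNeg c i' - a)‖ := by
    rw [← hdiff]; exact norm_sub_le _ _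
  have h4 : ‖(i : ℂ) + i'‖ = i + i' := by
    rw [show (i : ℂ) + i' = ((i + i' : ℕ) : ℂ) by push_cast; ring, Complex.norm_natCast]; push_cast; ring
  linarith

/-! ### Darts are determined by their two faces -/

/-- **A dart of `𝕋` is determined by its pair (left face, right face)**: the right face sees the
dart as the side opposite a unique vertex (`exists_sideIdx_of_triEdgeFaces`, `oppFace_injective`).
[folklore] -/
theorem eq_of_triEdgeFaces_eq {u v u' v' : Site 2} (h : triGraph.Adj u v) (h' : triGraph.Adj u' v')
    (e : triEdgeFaces ⟨(u, v), h⟩ = triEdgeFaces ⟨(u', v'), h'⟩) : u = u' ∧ v = v' := by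
  obtain ⟨J, h1, hv, hu⟩ := exists_sideIdx_of_triEdgeFaces h
  obtain ⟨J', h1', hv', hu'⟩ := exists_sideIdx_of_triEdgeFaces h'
  rw [e] at h1 hv hu
  have hJ : J = J' := TriMarkedDomain.oppFace_injective _ (h1.symm.trans h1')
  subst hJ
  exact ⟨hu.trans hu'.symm, hv.trans hv'.symm⟩

/-! ### Clusters along the two sides of an interface loop -/

section Chains

variable {ω : SiteConfig (Site 2)} {f₀ : HexVertex} {w : hexGraph.Walk f₀ f₀} (hw : IsSiteInterfaceLoop ω w)

include hw

/-- **The left sites lie in the open cluster of the first one**: `lv 0` is joined to every `lv j`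
by a path of open sites (consecutive left sites are equal or adjacent, `lv_succ_eq_or_adj`).
[cite: CamiaNewman2006, §4] -/
theorem IsSiteInterfaceLoop.pathIn_lv : ∀ {j : ℕ}, j < w.length → PathIn triGraph ω (hw.lv 0) (hw.lv j)
  | 0, hj => PathIn.refl (hw.lv_mem hj)
  | j + 1, hj => by
    refine (IsSiteInterfaceLoop.pathIn_lv (j := j) (by omega)).trans
      (PathIn.of_eq_or_adj (hw.lv_mem (by omega)) (hw.lv_mem hj) ?_)
    rcases hw.lv_succ_eq_or_adj hj with h | h
    · exact Or.inl h.symm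
    · exact Or.inr h

/-- **The right sites stay in the closed cluster of the first one**: if `rv 0` is joined by closed
sites to a set `T`, so is every `rv j` (consecutive right sites are equal or adjacent,
`rv_succ_eq_or_adj`, and closed). [cite: CamiaNewman2006, §4] -/
theorem IsSiteInterfaceLoop.exists_pathIn_rv {T : Set (Site 2)} (h0 : ∃ y ∈ T, PathIn triGraph ωᶜ (hw.rv 0) y) :
    ∀ {j : ℕ}, j < w.length → ∃ y ∈ T, PathIn triGraph ωᶜ (hw.rv j) y
  | 0, _ => h0
  | j + 1, hj => by
    obtain ⟨y, hy, hp⟩ := IsSiteInterfaceLoop.exists_pathIn_rv h0 (j := j) (by omega : j < w.length)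
    refine ⟨y, hy, (PathIn.of_eq_or_adj (hw.rv_not_mem hj) (hw.rv_not_mem (by omega)) ?_).trans hp⟩
    rcases hw.rv_succ_eq_or_adj hj with h | h
    · exact Or.inl h
    · exact Or.inr h.symm

end Chains

/-! ### The macroscopic interface loop -/

/-- **An open circuit inside two closed circuits forces a macroscopic interface loop.** Let `ω`
have finitely many open sites, `c` a lattice centre and `R ≥ 1`. If an open blocking circuit
lies in `4R < ‖· - c‖ < 8R`, a closed blocking circuit in `16R < ‖· - c‖ < 32R` and a closed
blocking circuit in `64R < ‖· - c‖ < 128R` (each meeting every walk of `𝕋` across its annulus),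
then some interface loop `w` of `ω` satisfies, at every mesh `δ > 0`: its trace lies in the disc
`B(δc, δ(128R + 2))`, and two points of its trace are at distance `≥ δ(R - 1)` — the deterministic
step of Camia–Newman 2006, proof of Thm 2 (ii) (see the module docstring for the argument; the
Jordan curve theorem is replaced by the winding-number lemma `not_polyTrace_subset_closedBall`).
[cite: CamiaNewman2006, Thm 2] -/
theorem exists_macroscopic_isSiteInterfaceLoop {ω : SiteConfig (Site 2)} (hfin : ω.Finite) {c : Site 2}
    {R : ℝ} (hR : 1 ≤ R) {δ : ℝ} (hδ : 0 < δ)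
    (hO : ∃ (v : Site 2) (O : triGraph.Walk v v),
      (∀ x ∈ O.support, x ∈ ω ∧ 4 * R < ‖triEmbed (x - c)‖ ∧ ‖triEmbed (x - c)‖ < 8 * R) ∧
      ∀ (x y : Site 2) (q : triGraph.Walk x y), ‖triEmbed (x - c)‖ ≤ 4 * R → 8 * R ≤ ‖triEmbed (y - c)‖ →
        ∃ z ∈ q.support, z ∈ O.support)
    (hC : ∃ (v : Site 2) (C : triGraph.Walk v v),
      (∀ x ∈ C.support, x ∉ ω ∧ 16 * R < ‖triEmbed (x - c)‖ ∧ ‖triEmbed (x - c)‖ < 32 * R) ∧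
      ∀ (x y : Site 2) (q : triGraph.Walk x y), ‖triEmbed (x - c)‖ ≤ 16 * R → 32 * R ≤ ‖triEmbed (y - c)‖ →
        ∃ z ∈ q.support, z ∈ C.support)
    (hCC : ∃ (v : Site 2) (C : triGraph.Walk v v),
      (∀ x ∈ C.support, x ∉ ω ∧ 64 * R < ‖triEmbed (x - c)‖ ∧ ‖triEmbed (x - c)‖ < 128 * R) ∧
      ∀ (x y : Site 2) (q : triGraph.Walk x y), ‖triEmbed (x - c)‖ ≤ 64 * R → 128 * R ≤ ‖triEmbed (y - c)‖ →
        ∃ z ∈ q.support, z ∈ C.support) :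
    ∃ (F : HexVertex) (w : hexGraph.Walk F F), IsSiteInterfaceLoop ω w ∧
      (∀ z ∈ polyTrace δ w, dist z (triMeshPoint δ c) < δ * (128 * R + 2)) ∧
      ∃ z ∈ polyTrace δ w, ∃ z' ∈ polyTrace δ w, δ * (R - 1) ≤ dist z z' := by
  classical
  obtain ⟨p₀, O, hOs, hOb⟩ := hO
  obtain ⟨vC, C, hCs, hCb⟩ := hC
  obtain ⟨vCC, CC, hCCs, hCCb⟩ := hCC
  have hR0 : 0 ≤ R := by linarith
  have hp₀ := hOs p₀ O.start_mem_support
  -- the ray from `p₀` meets `C`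
  set K₀ : ℕ := ⌈40 * R⌉₊ with hK₀
  obtain ⟨qray, hqray⟩ := exists_walk_raySite p₀ K₀
  obtain ⟨z₀, hz₀q, hz₀C⟩ := hCb _ _ qray
    (by rw [raySite_zero]; linarith [hp₀.2.2])
    (by
      have h1 := sub_le_norm_triEmbed_raySite_sub p₀ c K₀
      have h2 : (40 * R : ℝ) ≤ K₀ := Nat.le_ceil _
      linarith [hp₀.2.2])
  obtain ⟨i₀, hi₀K, rfl⟩ := hqray z₀ hz₀q
  -- the closed cluster `K'` of `C`; the first ray site in it
  set K' : Set (Site 2) := {x | ∃ y ∈ C.support, PathIn triGraph ωᶜ x y} with hK'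
  have hK'cl : ∀ x ∉ ω, ∀ y ∈ K', (x = y ∨ triGraph.Adj x y) → x ∈ K' := by
    rintro x hx y ⟨t, ht, hp⟩ hxy
    exact ⟨t, ht, (PathIn.of_eq_or_adj (show x ∈ ωᶜ from hx) hp.left_mem hxy).trans hp⟩
  have hK'sub : K' ⊆ ωᶜ := fun x ⟨_, _, hp⟩ ↦ hp.left_mem
  have hex : ∃ i, raySite p₀ i ∈ K' := ⟨i₀, raySite p₀ i₀, hz₀C, PathIn.refl (hCs _ hz₀C).1⟩
  set k₁ := Nat.find hex with hk₁
  have hk₁K' : raySite p₀ k₁ ∈ K' := Nat.find_spec hex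
  have hmin : ∀ i < k₁, raySite p₀ i ∉ K' := fun i hi ↦ Nat.find_min hex hi
  have hk₁i₀ : k₁ ≤ i₀ := Nat.find_min' hex ⟨raySite p₀ i₀, hz₀C, PathIn.refl (hCs _ hz₀C).1⟩
  have hk₁pos : k₁ ≠ 0 := by
    intro h0
    have : raySite p₀ k₁ ∈ ω := by rw [h0, raySite_zero]; exact hp₀.1
    exact hK'sub hk₁K' this
  obtain ⟨k₁', hk₁'⟩ : ∃ k, k₁ = k + 1 := ⟨k₁ - 1, by omega⟩
  set a := raySite p₀ k₁' with ha_def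
  set b := raySite p₀ k₁ with hb_def
  have hab : triGraph.Adj a b := by rw [ha_def, hb_def, hk₁']; exact adj_raySite_succ p₀ k₁'
  have hbω : b ∉ ω := hK'sub hk₁K'
  have haK' : a ∉ K' := hmin k₁' (by omega)
  have haω : a ∈ ω := by
    by_contra h
    exact haK' (hK'cl a h b hk₁K' (Or.inr hab))
  -- the interface loop through the dart `a → b`
  obtain ⟨F, w, hw, hfaces⟩ := exists_isSiteInterfaceLoop_of_adj hfin hab haω hbω
  have hlen : 0 < w.length := by have := hw.isCycle.three_le_length; omega
  have hlr : hw.lv 0 = a ∧ hw.rv 0 = b := by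
    obtain ⟨h', hfaces', -, -⟩ := hw.dart_spec hlen
    exact eq_of_triEdgeFaces_eq h' hab (hfaces'.trans hfaces.symm)
  refine ⟨F, w, hw, ?_, ?_⟩
  · -- localisation: the left sites are in the open cluster of `a`, inside the outer closed circuit
    intro z hz
    obtain ⟨j, hj, hzj⟩ := mem_polyTrace_iff.1 hz
    have hzl : dist z (hw.leftPt δ j) ≤ δ := mem_closedBall.1 (hw.polyPiece_subset_closedBall hδ.le hj hzj)
    have ha_norm : ‖triEmbed (a - c)‖ ≤ 64 * R := by
      have h1 := norm_triEmbed_raySite_sub_le p₀ c k₁'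
      have h2 : (k₁' : ℝ) ≤ 40 * R := by
        have : (k₁' : ℝ) + 1 ≤ i₀ := by exact_mod_cast (show k₁' + 1 ≤ i₀ by omega)
        have : (i₀ : ℝ) ≤ K₀ := by exact_mod_cast hi₀K
        have : (K₀ : ℝ) < 40 * R + 1 := Nat.ceil_lt_add_one (by positivity)
        linarith
      rw [ha_def]
      linarith [hp₀.2.2]
    have hnorm : ‖triEmbed (hw.lv j - c)‖ < 128 * R := by
      by_contra hge
      push Not at hge
      obtain ⟨q, hq⟩ := (hw.pathIn_lv hj).exists_walk
      obtain ⟨x, hxq, hxCC⟩ := hCCb _ _ q (by rw [hlr.1]; exact ha_norm) hge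
      exact (hCCs x hxCC).1 (hq x hxq)
    have hdl : dist (hw.leftPt δ j) (triMeshPoint δ c) < δ * (128 * R) := by
      rw [IsSiteInterfaceLoop.leftPt, dist_triMeshPoint_eq hδ.le]
      exact mul_lt_mul_of_pos_left hnorm hδ
    calc dist z (triMeshPoint δ c) ≤ dist z (hw.leftPt δ j) + dist (hw.leftPt δ j) (triMeshPoint δ c) :=
          dist_triangle _ _ _
      _ < δ + δ * (128 * R) := add_lt_add_of_le_of_lt hzl hdl
      _ ≤ δ * (128 * R + 2) := by nlinarith
  · -- size: the trace leaves the disc `B̄(δ a, δ R)`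
    -- far sites of `O` and of `C`
    obtain ⟨ostar, hostarO, hostar⟩ := exists_mem_support_lt_norm_of_blocking (by positivity)
      (fun x hx ↦ (hOs x hx).2.1) hOb a
    obtain ⟨cstar, hcstarC, hcstar⟩ := exists_mem_support_lt_norm_of_blocking (by positivity)
      (fun x hx ↦ (hCs x hx).2.1) hCb a
    -- the left chain: back along the ray to `p₀`, then along `O` to `ostar`
    obtain ⟨qa, hqa⟩ := exists_walk_raySite p₀ k₁'
    set WL : triGraph.Walk a ostar := (qa.reverse.copy rfl (raySite_zero p₀)).append (O.takeUntil ostar hostarO)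
      with hWL
    have hWLsupp : ∀ x ∈ WL.support, x ∉ K' := by
      intro x hx
      rw [hWL, SimpleGraph.Walk.mem_support_append_iff, SimpleGraph.Walk.support_copy,
        SimpleGraph.Walk.support_reverse, List.mem_reverse] at hx
      rcases hx with hx | hx
      · obtain ⟨k, hk, rfl⟩ := hqa x hx
        exact hmin k (by omega)
      · have hxO := O.support_takeUntil_subset_support hostarO hx
        exact fun hK ↦ hK'sub hK (hOs x hxO).1
    -- the right chain: through `K'` to `C`, then along `C` to `cstar`
    obtain ⟨y, hyC, hpy⟩ := id hk₁K'
    obtain ⟨qb, hqb⟩ := hpy.exists_walk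
    have hcstar' : cstar ∈ (C.rotate y hyC).support := by
      rw [SimpleGraph.Walk.mem_support_rotate_iff]; exact hcstarC
    set WR : triGraph.Walk b cstar := qb.append ((C.rotate y hyC).takeUntil cstar hcstar') with hWR
    have hWRsupp : ∀ x ∈ WR.support, x ∉ ω := by
      intro x hx
      rw [hWR, SimpleGraph.Walk.mem_support_append_iff] at hx
      rcases hx with hx | hx
      · exact hqb x hx
      · have hx' := (C.rotate y hyC).support_takeUntil_subset_support hcstar' hx
        rw [SimpleGraph.Walk.mem_support_rotate_iff] at hx'
        exact (hCs x hx').1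
    -- all right sites of `w` are in `K'`
    have hrvK' : ∀ j < w.length, hw.rv j ∈ K' := fun j hj ↦
      hw.exists_pathIn_rv (by rw [hlr.2]; exact hk₁K') hj
    -- apply the macroscopic-loop lemma
    have hnot := hw.not_polyTrace_subset_closedBall hδ hlen (x := triMeshPoint δ a) (ρ := δ * R)
      WL.getVert WL.length (by rw [SimpleGraph.Walk.getVert_zero, hlr.1])
      (fun k hk ↦ Or.inr (WL.adj_getVert_succ hk))
      (fun k hk j hj ↦ ⟨fun hh ↦ hWLsupp _ (WL.getVert_mem_support (k + 1)) (hh.2 ▸ hrvK' j hj),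
        fun hh ↦ hWLsupp _ (WL.getVert_mem_support k) (hh.1 ▸ hrvK' j hj)⟩)
      (by
        rw [SimpleGraph.Walk.getVert_length, dist_triMeshPoint_eq hδ.le]
        nlinarith)
      WR.getVert WR.length (by rw [SimpleGraph.Walk.getVert_zero, hlr.2])
      (fun k hk ↦ Or.inr (WR.adj_getVert_succ hk))
      (fun k hk j hj ↦ ⟨fun hh ↦ hWRsupp _ (WR.getVert_mem_support k) (hh.1 ▸ hw.lv_mem hj),
        fun hh ↦ hWRsupp _ (WR.getVert_mem_support (k + 1)) (hh.2 ▸ hw.lv_mem hj)⟩)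
      (by
        rw [SimpleGraph.Walk.getVert_length, dist_triMeshPoint_eq hδ.le]
        nlinarith)
    obtain ⟨z, hz, hzfar⟩ := Set.not_subset.1 hnot
    rw [mem_closedBall, not_le] at hzfar
    refine ⟨z, hz, polyPt δ w 0, polyPiece_subset_polyTrace hlen (left_mem_segment _ _ _), ?_⟩
    have h0 : dist (polyPt δ w 0) (triMeshPoint δ a) ≤ δ := by
      rw [← hlr.1]; exact (hw.dist_polyPt_leftPt_le hδ.le hlen).1
    have := dist_triangle z (polyPt δ w 0) (triMeshPoint δ a)
    nlinarith [dist_comm (polyPt δ w 0) z]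

end Literature.Probability.Percolation
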